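import Mathlib
import Summits.KontsevichZagierPeriods.KontsevichZagierPeriods.Theorems.InverseLandauTateFamilyKernelStubIsotopyThree

/-!
# `TateFamilyKernel` — the FOLD class of vanishing Tate fibres is a relation class, dimension 3
# (line `Sketch`, stub `stub_foldClass3`)

Crux `TateFamilyKernel` (stmt-KontsevichZagierPeriods-9130, route `InverseLandau`), line `Sketch`;
the dimension-3 analogue of `stub_foldClass` (file `InverseLandauTateFamilyKernelStubFoldClass.lean`).
Data (variables `X 0 = w₀`, `X 1 = w₁`, `X 2 = w₂`, `X 3 = ϖ` of `ℚ[w₀, w₁, w₂, ϖ]`, and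
`X 0 = y₀`, `X 1 = y₁`, `X 2 = y₂`, `X 3 = ϖ` for the target cube): a polynomial `c(w₀, w₁, w₂, ϖ)`
vanishing on both faces `w₂ = 0` and `w₂ = 1` (divisibilities `X 2 ∣ c`, `(1 - X 2) ∣ c`), a
rational function `h = B/E ∈ ℚ(y₀, y₁, y₂, ϖ)` and a real-algebraic `ϖ₀` such that
`E(w₀, w₁, s·c(w, ϖ₀), ϖ₀) ≠ 0` for `w ∈ [0,1]³`, `s ∈ [0,1]`. Conclusion (`stub_foldClass3`): every
tame cube representation of the FOLD ELEMENT `h(w₀, w₁, c(w, ϖ₀), ϖ₀) · ∂_{w₂} c(w, ϖ₀)` is a KZ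
relation.

Proof. The fold element is the pull-back `Φ^*(h dy₀ ∧ dy₁ ∧ dy₂)` under the face-compatible
polynomial self-map `Φ(w) = (w₀, w₁, c(w))` of the cube, of degree `0` in the `w₂`-direction (both
faces `w₂ ∈ {0, 1}` go to the face `y₂ = 0`). The straight-line isotopy `Φ_s(w) = (w₀, w₁, s·c(w))`,
`s ∈ [0,1]`, from the degenerate map `Φ₀ = (w₀, w₁, 0)` (Jacobian `0`) to `Φ₁ = Φ` is again
face-compatible, so the transport theorem `stub_isotopyThree` (rule (2) along a polynomial isotopy
of the cube is an `m = 1` Ayoub certificate) applies, in its variables `X 0, X 1, X 2 = w`,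
`X 3 = s`, `X 4 = ϖ` of `ℚ[w₀, w₁, w₂, s, ϖ]`, with `φ₁ = X 0`, `φ₂ = X 1`, `φ₃ = X 3 * rename ι c`
for the re-indexing `ι = ![0, 1, 2, 4]` (`w ↦ w`, `ϖ ↦ X 4`, skipping `s`), face constants
`c₁₀ = 0`, `c₁₁ = 1`, `c₂₀ = 0`, `c₂₁ = 1`, `c₃₀ = c₃₁ = 0`: the `3 × 3` Jacobian collapses to
`∂₂φ₃ = s · (∂₂c)(w, ϖ)` (`Fold3.jacobian`), so `[h∘Φ_s · J_s]_{s=0}^{s=1}` is exactly the fold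
element, and `E∘Φ_s ≠ 0` on `[0,1]⁴` is the hypothesis at `s = w₃`. The helper lemmas are stated
for a map `ι` with the hypothesis `ι = ![0, 1, 2, 4]` (short statements, opaque `ι` in the proof).
What is NOT here: the general descent of the crux (fibres of arbitrary vanishing families).
References: Kontsevich–Zagier 2001 §1.2 rules (2), (3); Ayoub, EMS Newsl. 91 (2014) Def. 10.
-/

noncomputable section

open MeasureTheory Set MvPolynomial
open Literature.NumberTheory.Transcendental

namespace Summit.KontsevichZagierPeriods.InverseLandau.TateFamilyKernel.Descent

namespace Fold3

/-! ### The re-indexing `ι = ![0, 1, 2, 4]` and the isotopy `Φ_s = (w₀, w₁, s·c)` -/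

/-- The re-indexing `ι = (0 ↦ 0, 1 ↦ 1, 2 ↦ 2, 3 ↦ 4)` of `ℚ[w₀, w₁, w₂, ϖ]` into
`ℚ[w₀, w₁, w₂, s, ϖ]` is injective. [folklore] -/
theorem iota_injective {ι : Fin (3 + 1) → Fin (3 + 1 + 1)} (hι : ι = ![0, 1, 2, 4]) :
    Function.Injective ι := by
  subst hι
  decide

/-- The re-indexing fixes the fold direction `w₂`: `ι 2 = 2`. [folklore] -/
theorem iota_two {ι : Fin (3 + 1) → Fin (3 + 1 + 1)} (hι : ι = ![0, 1, 2, 4]) : ι 2 = 2 := by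
  subst hι
  rfl

/-- Evaluating a re-indexed polynomial at the double slice `(z, s, ϖ₀)` forgets `s`:
`(rename ι P)(z₀, z₁, z₂, s, ϖ₀) = P(z₀, z₁, z₂, ϖ₀)`. [folklore] -/
theorem aeval_rename_iota {ι : Fin (3 + 1) → Fin (3 + 1 + 1)} (hι : ι = ![0, 1, 2, 4]) (ϖ₀ : ℝ)
    (z : Fin 3 → ℝ) (s : ℝ) (P : MvPolynomial (Fin (3 + 1)) ℚ) :
    aeval (Fin.snoc (Fin.snoc z s : Fin (3 + 1) → ℝ) ϖ₀ : Fin (3 + 1 + 1) → ℝ) (rename ι P) =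
      aeval (Fin.snoc z ϖ₀ : Fin (3 + 1) → ℝ) P := by
  have h : (Fin.snoc (Fin.snoc z s : Fin (3 + 1) → ℝ) ϖ₀ : Fin (3 + 1 + 1) → ℝ) ∘ ι =
      (Fin.snoc z ϖ₀ : Fin (3 + 1) → ℝ) := by
    subst hι
    funext j
    fin_cases j <;> rfl
  rw [aeval_rename, h]

/-- **The Jacobian of the straight-line isotopy `Φ_s = (w₀, w₁, s·c(w₀, w₁, w₂, ϖ))`**: the `3 × 3`
determinant `det(∂ⱼφᵢ)_{j = 0,1,2}` of `φ₁ = w₀`, `φ₂ = w₁`, `φ₃ = s·c` collapses to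
`∂₂φ₃ = s · (∂₂ c)(w₀, w₁, w₂, ϖ)` (re-indexed). [folklore] -/
theorem jacobian {ι : Fin (3 + 1) → Fin (3 + 1 + 1)} (hι : ι = ![0, 1, 2, 4])
    (c : MvPolynomial (Fin (3 + 1)) ℚ) :
    pderiv 0 (X 0 : MvPolynomial (Fin (3 + 1 + 1)) ℚ) *
          (pderiv 1 (X 1 : MvPolynomial (Fin (3 + 1 + 1)) ℚ) * pderiv 2 (X 3 * rename ι c) -
            pderiv 2 (X 1 : MvPolynomial (Fin (3 + 1 + 1)) ℚ) * pderiv 1 (X 3 * rename ι c)) -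
        pderiv 1 (X 0 : MvPolynomial (Fin (3 + 1 + 1)) ℚ) *
          (pderiv 0 (X 1 : MvPolynomial (Fin (3 + 1 + 1)) ℚ) * pderiv 2 (X 3 * rename ι c) -
            pderiv 2 (X 1 : MvPolynomial (Fin (3 + 1 + 1)) ℚ) * pderiv 0 (X 3 * rename ι c)) +
        pderiv 2 (X 0 : MvPolynomial (Fin (3 + 1 + 1)) ℚ) *
          (pderiv 0 (X 1 : MvPolynomial (Fin (3 + 1 + 1)) ℚ) * pderiv 1 (X 3 * rename ι c) -
            pderiv 1 (X 1 : MvPolynomial (Fin (3 + 1 + 1)) ℚ) * pderiv 0 (X 3 * rename ι c)) =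
      X 3 * rename ι (pderiv 2 c) := by
  have h : pderiv 2 (rename ι c) = rename ι (pderiv 2 c) := by
    have h' := pderiv_rename (iota_injective hι) 2 c
    rwa [iota_two hι] at h'
  have n01 : (0 : Fin (3 + 1 + 1)) ≠ 1 := by decide
  have n02 : (0 : Fin (3 + 1 + 1)) ≠ 2 := by decide
  have n10 : (1 : Fin (3 + 1 + 1)) ≠ 0 := by decide
  have n12 : (1 : Fin (3 + 1 + 1)) ≠ 2 := by decide
  have n32 : (3 : Fin (3 + 1 + 1)) ≠ 2 := by decide
  simp only [pderiv_X_self, pderiv_X_of_ne n01, pderiv_X_of_ne n02, pderiv_X_of_ne n10,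
    pderiv_X_of_ne n12, one_mul, zero_mul, sub_zero, add_zero]
  rw [pderiv_mul, pderiv_X_of_ne n32, zero_mul, zero_add, h]

/-- The value of `s · (rename ι P)` at the double slice `(z, s, ϖ₀)` is `s · P(z, ϖ₀)`.
[folklore] -/
theorem aeval_X_three_mul_rename {ι : Fin (3 + 1) → Fin (3 + 1 + 1)} (hι : ι = ![0, 1, 2, 4])
    (ϖ₀ : ℝ) (z : Fin 3 → ℝ) (s : ℝ) (P : MvPolynomial (Fin (3 + 1)) ℚ) :
    aeval (Fin.snoc (Fin.snoc z s : Fin (3 + 1) → ℝ) ϖ₀ : Fin (3 + 1 + 1) → ℝ)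
        (X 3 * rename ι P) =
      s * aeval (Fin.snoc z ϖ₀ : Fin (3 + 1) → ℝ) P := by
  rw [map_mul, aeval_X, aeval_rename_iota hι]
  rfl

/-- The substitution datum of the isotopy, read at the double slice `(z, s, ϖ₀)`:
`(φ₁, φ₂, φ₃, ϖ)(z, s, ϖ₀) = (z₀, z₁, s·c(z, ϖ₀), ϖ₀)`. [folklore] -/
theorem isotopy_apply {ι : Fin (3 + 1) → Fin (3 + 1 + 1)} (hι : ι = ![0, 1, 2, 4])
    (c : MvPolynomial (Fin (3 + 1)) ℚ) (ϖ₀ : ℝ) (z : Fin 3 → ℝ) (s : ℝ) :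
    (fun i : Fin (3 + 1) =>
        aeval (Fin.snoc (Fin.snoc z s : Fin (3 + 1) → ℝ) ϖ₀ : Fin (3 + 1 + 1) → ℝ)
          ((![X 0, X 1, X 3 * rename ι c, X 4] :
            Fin (3 + 1) → MvPolynomial (Fin (3 + 1 + 1)) ℚ) i)) =
      (Fin.snoc (![z 0, z 1, s * aeval (Fin.snoc z ϖ₀ : Fin (3 + 1) → ℝ) c] : Fin 3 → ℝ) ϖ₀ :
        Fin (3 + 1) → ℝ) := by
  funext i
  fin_cases i
  · show aeval (Fin.snoc (Fin.snoc z s : Fin (3 + 1) → ℝ) ϖ₀ : Fin (3 + 1 + 1) → ℝ)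
        (X 0 : MvPolynomial (Fin (3 + 1 + 1)) ℚ) = z 0
    exact aeval_X _ _
  · show aeval (Fin.snoc (Fin.snoc z s : Fin (3 + 1) → ℝ) ϖ₀ : Fin (3 + 1 + 1) → ℝ)
        (X 1 : MvPolynomial (Fin (3 + 1 + 1)) ℚ) = z 1
    exact aeval_X _ _
  · show aeval (Fin.snoc (Fin.snoc z s : Fin (3 + 1) → ℝ) ϖ₀ : Fin (3 + 1 + 1) → ℝ)
        (X 3 * rename ι c) = s * aeval (Fin.snoc z ϖ₀ : Fin (3 + 1) → ℝ) c
    exact aeval_X_three_mul_rename hι ϖ₀ z s c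
  · show aeval (Fin.snoc (Fin.snoc z s : Fin (3 + 1) → ℝ) ϖ₀ : Fin (3 + 1 + 1) → ℝ)
        (X 4 : MvPolynomial (Fin (3 + 1 + 1)) ℚ) = ϖ₀
    exact aeval_X _ _

/-- Pulling back along the isotopy and double-slicing: for every `P ∈ ℚ[y₀, y₁, y₂, ϖ]`,
`(P∘Φ)(z, s, ϖ₀) = P(z₀, z₁, s·c(z, ϖ₀), ϖ₀)`. [folklore] -/
theorem aeval_bind₁_isotopy {ι : Fin (3 + 1) → Fin (3 + 1 + 1)} (hι : ι = ![0, 1, 2, 4])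
    (c : MvPolynomial (Fin (3 + 1)) ℚ) (ϖ₀ : ℝ) (z : Fin 3 → ℝ) (s : ℝ)
    (P : MvPolynomial (Fin (3 + 1)) ℚ) :
    aeval (Fin.snoc (Fin.snoc z s : Fin (3 + 1) → ℝ) ϖ₀ : Fin (3 + 1 + 1) → ℝ)
        (bind₁ ![X 0, X 1, X 3 * rename ι c, X 4] P) =
      aeval (Fin.snoc (![z 0, z 1, s * aeval (Fin.snoc z ϖ₀ : Fin (3 + 1) → ℝ) c] : Fin 3 → ℝ) ϖ₀ :
        Fin (3 + 1) → ℝ) P :=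
  (aeval_bind₁ _ _ _).trans
    (congrArg (fun v : Fin (3 + 1) → ℝ => aeval v P) (isotopy_apply hι c ϖ₀ z s))

end Fold3

open Fold3 in
/-- STUB `stub_foldClass3` of line `Sketch` — **the FOLD class is a relation class, dimension 3.**
Data: `c ∈ ℚ[w₀, w₁, w₂, ϖ]` vanishing on both faces `w₂ = 0`, `w₂ = 1` (divisibility by `X 2` and
by `1 - X 2`), a rational `h = B/E ∈ ℚ(y₀, y₁, y₂, ϖ)`, and a real-algebraic `ϖ₀` with
`E(w₀, w₁, s·c(w, ϖ₀), ϖ₀) ≠ 0` for `(w, s) ∈ [0,1]³ × [0,1]`. Conclusion: every tame cube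
representation of the fold element `h(w₀, w₁, c(w, ϖ₀), ϖ₀) · (∂_{w₂} c)(w, ϖ₀)` — the pull-back of
`h dy₀ dy₁ dy₂` under the degree-`0` face-compatible map `Φ(w) = (w₀, w₁, c(w))` — is a relation.
Proof: the straight-line family `Φ_s = (w₀, w₁, s·c(w))` is a face-compatible polynomial isotopy
from a map with zero Jacobian to `Φ`, with Jacobian `s·∂₂c` (`Fold3.jacobian`); apply
`stub_isotopyThree` with `φ₁ = X 0`, `φ₂ = X 1`, `φ₃ = X 3 * rename ![0, 1, 2, 4] c`,
`c₁₀ = 0`, `c₁₁ = 1`, `c₂₀ = 0`, `c₂₁ = 1`, `c₃₀ = c₃₁ = 0`.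
[cite: KontsevichZagier2001, §1.2 rules (2), (3)] [cite: Ayoub2014, Def. 10] -/
theorem stub_foldClass3 (c B E : MvPolynomial (Fin (3 + 1)) ℚ)
    (hc0 : ∃ R : MvPolynomial (Fin (3 + 1)) ℚ, c = X 2 * R)
    (hc1 : ∃ R : MvPolynomial (Fin (3 + 1)) ℚ, c = (1 - X 2) * R)
    (ϖ₀ : ℝ) (halg : IsAlgebraic ℚ ϖ₀)
    (hE : ∀ w ∈ KZ.cube 3, ∀ s ∈ Icc (0 : ℝ) 1,
      aeval (Fin.snoc (![w 0, w 1, s * aeval (Fin.snoc w ϖ₀ : Fin (3 + 1) → ℝ) c] : Fin 3 → ℝ) ϖ₀ :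
        Fin (3 + 1) → ℝ) E ≠ 0) :
    ∀ R : KZ.IntegralRep 3, R.IsTameCube →
      (∀ w ∈ KZ.cube 3, R.integrand w =
        aeval (Fin.snoc (![w 0, w 1, aeval (Fin.snoc w ϖ₀ : Fin (3 + 1) → ℝ) c] : Fin 3 → ℝ) ϖ₀ :
            Fin (3 + 1) → ℝ) B /
          aeval (Fin.snoc (![w 0, w 1, aeval (Fin.snoc w ϖ₀ : Fin (3 + 1) → ℝ) c] : Fin 3 → ℝ) ϖ₀ :
            Fin (3 + 1) → ℝ) E *
          aeval (Fin.snoc w ϖ₀ : Fin (3 + 1) → ℝ) (pderiv 2 c)) →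
      KZ.of R ∈ KZ.relations := by
  intro R hR hRi
  -- the re-indexing `ι : ℚ[w₀, w₁, w₂, ϖ] → ℚ[w₀, w₁, w₂, s, ϖ]`, kept opaque behind `hι`
  obtain ⟨ι, hι⟩ : ∃ ι : Fin (3 + 1) → Fin (3 + 1 + 1), ι = ![0, 1, 2, 4] := ⟨_, rfl⟩
  obtain ⟨R₀, hR₀⟩ := hc0
  obtain ⟨R₁, hR₁⟩ := hc1
  refine stub_isotopyThree (X 0) (X 1) (X 3 * rename ι c) B E 0 1 0 1 0 0
    ⟨1, by rw [C_0, zero_add, mul_one]⟩ ⟨-1, by rw [C_1]; ring⟩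
    ⟨1, by rw [C_0, zero_add, mul_one]⟩ ⟨-1, by rw [C_1]; ring⟩
    ⟨X 3 * rename ι R₀, ?_⟩ ⟨X 3 * rename ι R₁, ?_⟩ ϖ₀ halg (fun w hw => ?_) R hR fun z hz => ?_
  · -- the face `w₂ = 0` goes to the face `y₂ = 0`
    rw [hR₀, map_mul, rename_X, iota_two hι, C_0, zero_add]
    ring
  · -- the face `w₂ = 1` goes to the face `y₂ = 0`
    rw [hR₁, map_mul, map_sub, map_one, rename_X, iota_two hι, C_0, zero_add]
    ring
  · -- `E∘Φ_s ≠ 0` on the closed cube `[0,1]⁴`: the hypothesis `hE` at `s = w₃`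
    obtain ⟨z, s, rfl⟩ : ∃ (z : Fin 3 → ℝ) (s : ℝ), (Fin.snoc z s : Fin (3 + 1) → ℝ) = w :=
      ⟨Fin.init w, w (Fin.last 3), Fin.snoc_init_self w⟩
    obtain ⟨hz, hs0, hs1⟩ := KZ.snoc_mem_cube_iff.1 hw
    rw [aeval_bind₁_isotopy hι]
    exact hE z hz s ⟨hs0, hs1⟩
  · -- the integrand is `[h∘Φ_s · J_s]_{s=0}^{s=1}` (`J_s = s·∂₂c`)
    rw [hRi z hz, jacobian hι]
    simp only [aeval_bind₁_isotopy hι, aeval_X_three_mul_rename hι, one_mul, zero_mul, mul_zero,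
      sub_zero]

end Summit.KontsevichZagierPeriods.InverseLandau.TateFamilyKernel.Descent
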